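import Summits.ResolutionOfSingularities.KangarooAtlas.MizutaniLemma29Cases
import Summits.ResolutionOfSingularities.KangarooAtlas.MizutaniSharp
import Summits.ResolutionOfSingularities.KangarooAtlas.MizutaniBoxSubst
import Summits.ResolutionOfSingularities.KangarooAtlas.MizutaniHeatKernel
import HarnessLib

/-!
# Mizutani's Lemma 2.9 (2) — the case of a degenerate symbol with `w ≠ 0`: `dim_L ker D ≤ p`

Cell topic `Summits/ResolutionOfSingularities/KangarooAtlas` (pub-rosobs); namespace
`Summit.ResolutionOfSingularities.KangarooAtlas.Mizutani`.  Part of the Lean transcription of Mizutani 1973 §2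
around the in-house note MIZUTANI-PROOF-g59 (AI-written, AI-audited; *AI review is weaker than expert review*; not a
resolution theorem).

Setting of Lemma 2.9 in tower form (`h : IsRootTower L K p x a`, `p ≠ 2`, `D` of order `≤ 2` with
`D 1 = D a₀ = D a₁ = 0`), in the case `γ = D(a₁²) ≠ 0`, `D(a₀²)γ = D(a₀a₁)²` (the symbol is a square) and
`w = D'(β') ≠ 0` where `β' = D(a₀a₁)/γ`, `D' = β'∂₀ + ∂₁`.  By `eq_smul_comp_sub_smul`,
`D = (γ/2)·(D' ∘ D' − w ∂₀)`.  Base change along `Ω̃ : K ⊗_L K ≅ K[δ₀, δ₁]/(δ^p)` (`MizutaniSharp`) turns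
`E = D'∘D' − w∂₀` into `(tau β' ∂₀ + ∂₁)² − tau w · ∂₀`; the substitution `δ₀ = u + β'σ + (w/2)σ²`, `δ₁ = σ`
(`MizutaniBoxSubst`) turns it into the perturbed heat operator `(∂σ + ε∂u)² − ŵ ∂u` with `ε` of `(2,1)`-weight `≥ 2`
and `ŵ ≡ w`; by `finrank_ker_heatPert_le` its kernel has dimension `≤ p`, hence (`finrank_ker_le_finrank_ker_sharp`)
**`IsRootTower.finrank_ker_le_of_sq_of_ne_zero`: `dim_L ker D ≤ p < 2p`.**  This is the computation Mizutani
alludes to as «(½a)^{p−2}(D₁(a) + ½aD₂(a)) = 0» (p. 94); here it is replaced by a weighted initial-form argument.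

References: [Mizutani1973HironakaGroupSchemes] Lemma 2.9 (2), p. 93–94.
-/

open MvPolynomial TensorProduct Literature.AlgebraicGeometry.Resolution

namespace Summit.ResolutionOfSingularities.KangarooAtlas.Mizutani

universe u

section Heat

variable {L K : Type u} [Field L] [Field K] [Algebra L K] {p : ℕ} [hp : Fact p.Prime] [CharP K p]
  {x : Fin 2 → L} {a : Fin 2 → K}

/-! ### The Taylor expansion to first order -/

/-- Weight with all weights `1` is the degree. [folklore] -/
theorem weight_one_eq_degree (M : Fin 2 →₀ ℕ) : Finsupp.weight (fun _ => (1 : ℕ)) M = M.degree := by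
  rw [Finsupp.degree_eq_weight_one]

/-- **Taylor expansion to first order**: `tau y ≡ y + (∂₀y) δ₀ + (∂₁y) δ₁` modulo monomials of degree `≥ 2`.
[cite: EGAIV4, Thm. 16.11.2] -/
theorem IsRootTower.tau_sub_mem_wdegIdeal (h : IsRootTower L K (p ^ 1) x a) (hp2 : p ≠ 2) (y : K) :
    h.tau y - Ideal.Quotient.mk _ (C y + C (h.hsD (Finsupp.single 0 1) y) * X 0 + C (h.hsD (Finsupp.single 1 1) y) * X 1) ∈
      wdegIdeal K 2 (p ^ 1) (fun _ => 1) 2 := by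
  classical
  rw [mem_wdegIdeal_iff_coeff]
  intro M hM
  rw [weight_one_eq_degree] at hM
  have hMbox : InBox (p ^ 1) M := inBox_of_degree_le_two hp2 (by omega)
  rw [map_sub, coeff_sub, ← h.hsD_apply, truncQ_mk, coeff_trunc, if_pos hMbox]
  simp only [coeff_add, coeff_C_mul, coeff_C, coeff_X]
  rcases eq_zero_or_exists_single_of_degree_le_one (by omega : M.degree ≤ 1) with h0 | ⟨l, hl⟩
  · subst h0
    rw [h.hsD_zero_apply, if_pos rfl, if_neg (Finsupp.single_ne_zero.mpr one_ne_zero),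
      if_neg (Finsupp.single_ne_zero.mpr one_ne_zero)]
    ring
  · subst hl
    rw [if_neg (Finsupp.single_ne_zero.mpr one_ne_zero).symm]
    fin_cases l <;> simp [Finsupp.single_eq_single_iff]

/-- **Taylor expansion after the substitution** `θ̄ = substQ b c`, for a weight `ω` with `ω i ≥ 1`:
`θ̄ (tau y) − [y + (∂₀y)·θ̄[X₀] + (∂₁y)·[X₁]]` has `ω`-weight `≥ 2`. [folklore] -/
theorem IsRootTower.substQ_tau_sub_mem (h : IsRootTower L K (p ^ 1) x a) (hp2 : p ≠ 2) (b c : K) (ω : Fin 2 → ℕ)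
    (hω : ∀ i, 1 ≤ ω i) (y : K) :
    substQ K b c (h.tau y) - (Ideal.Quotient.mk _ (C y) +
        Ideal.Quotient.mk _ (C (h.hsD (Finsupp.single 0 1) y)) * substQ K b c (Ideal.Quotient.mk _ (X 0)) +
        Ideal.Quotient.mk _ (C (h.hsD (Finsupp.single 1 1) y)) * Ideal.Quotient.mk _ (X 1)) ∈
      wdegIdeal K 2 (p ^ 1) ω 2 := by
  set r := h.tau y - Ideal.Quotient.mk _ (C y + C (h.hsD (Finsupp.single 0 1) y) * X 0 +
    C (h.hsD (Finsupp.single 1 1) y) * X 1) with hr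
  have hr2 := h.tau_sub_mem_wdegIdeal hp2 y
  -- `θ̄ r ∈ wdegIdeal ω 2`
  have hθr : substQ K b c r ∈ wdegIdeal K 2 (p ^ 1) ω 2 := by
    rw [← mk_truncQ r]
    refine substQ_mk_mem_wdegIdeal b c ω hω fun M hM => ?_
    rw [← weight_one_eq_degree]
    exact (mem_wdegIdeal_iff (ω := fun _ => 1)).mp hr2 M hM
  have heq : substQ K b c (h.tau y) - (Ideal.Quotient.mk _ (C y) +
        Ideal.Quotient.mk _ (C (h.hsD (Finsupp.single 0 1) y)) * substQ K b c (Ideal.Quotient.mk _ (X 0)) +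
        Ideal.Quotient.mk _ (C (h.hsD (Finsupp.single 1 1) y)) * Ideal.Quotient.mk _ (X 1)) = substQ K b c r := by
    rw [hr]
    simp only [map_sub, map_add, map_mul, substQ_mk, substHom_C, substHom_X_one, substHom_X_zero]
  rw [heq]
  exact hθr

/-! ### The conjugated operator is a perturbed heat operator -/

/-- The first-order data of the completed square, transported and substituted: with `θ̄ = substQ β' (w/2)`,
`θ̄ (tau β') − β' − w σ` has `(2,1)`-weight `≥ 2` when `w = β'∂₀β' + ∂₁β'`. [cite: Mizutani1973HironakaGroupSchemes, Lemma 2.9 (2) (proof outline)] -/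
theorem IsRootTower.eps_mem_wdegIdeal (h : IsRootTower L K (p ^ 1) x a) (hp2 : p ≠ 2) (β' : K) :
    let w : K := β' * h.hsD (Finsupp.single 0 1) β' + h.hsD (Finsupp.single 1 1) β'
    substQ K β' (w / 2) (h.tau β') - Ideal.Quotient.mk _ (C β') - Ideal.Quotient.mk _ (C w) * Ideal.Quotient.mk _ (X 1) ∈
      wdegIdeal K 2 (p ^ 1) heatWeight 2 := by
  intro w
  have h2 : (2 : K) ≠ 0 := two_ne_zero_of_ne_two hp2
  have hmain := h.substQ_tau_sub_mem hp2 β' (w / 2) heatWeight (fun i => by fin_cases i <;> simp) β'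
  have hX0 : substQ K β' (w / 2) (Ideal.Quotient.mk _ (X 0)) =
      Ideal.Quotient.mk _ (X 0) + Ideal.Quotient.mk _ (C β') * Ideal.Quotient.mk _ (X 1) +
        Ideal.Quotient.mk _ (C (w / 2)) * Ideal.Quotient.mk _ (X 1) ^ 2 := by
    rw [substQ_mk, substHom_X_zero, map_add, map_add, map_mul, map_mul, map_pow]
  -- the difference between the two expressions is `(∂₀β')·u + (∂₀β' · w/2)·σ²`, of weight ≥ 2
  have hu : Ideal.Quotient.mk (boxIdeal (Fin 2) K (p ^ 1)) (X 0) ∈ wdegIdeal K 2 (p ^ 1) heatWeight 2 :=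
    mk_X_mem_wdegIdeal heatWeight 0
  have hσ2 : Ideal.Quotient.mk (boxIdeal (Fin 2) K (p ^ 1)) (X 1) ^ 2 ∈ wdegIdeal K 2 (p ^ 1) heatWeight 2 := by
    have := mk_X_mem_wdegIdeal (K := K) (q := p ^ 1) heatWeight 1
    rw [heatWeight_one] at this
    rw [pow_two]
    exact mul_mem_wdegIdeal heatWeight this this
  have hdiff : substQ K β' (w / 2) (h.tau β') - Ideal.Quotient.mk _ (C β') - Ideal.Quotient.mk _ (C w) * Ideal.Quotient.mk _ (X 1) =
      (substQ K β' (w / 2) (h.tau β') - (Ideal.Quotient.mk _ (C β') +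
        Ideal.Quotient.mk _ (C (h.hsD (Finsupp.single 0 1) β')) * substQ K β' (w / 2) (Ideal.Quotient.mk _ (X 0)) +
        Ideal.Quotient.mk _ (C (h.hsD (Finsupp.single 1 1) β')) * Ideal.Quotient.mk _ (X 1))) +
      (Ideal.Quotient.mk _ (C (h.hsD (Finsupp.single 0 1) β')) * Ideal.Quotient.mk _ (X 0) +
        Ideal.Quotient.mk _ (C (h.hsD (Finsupp.single 0 1) β' * (w / 2))) * Ideal.Quotient.mk _ (X 1) ^ 2) := by
    rw [hX0]
    have hw' : (Ideal.Quotient.mk (boxIdeal (Fin 2) K (p ^ 1)) (C w)) =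
        Ideal.Quotient.mk _ (C (h.hsD (Finsupp.single 0 1) β')) * Ideal.Quotient.mk _ (C β') +
          Ideal.Quotient.mk _ (C (h.hsD (Finsupp.single 1 1) β')) := by
      rw [← map_mul, ← map_add, ← C_mul, ← C_add]
      congr 2
      show β' * h.hsD (Finsupp.single 0 1) β' + h.hsD (Finsupp.single 1 1) β' = _
      ring
    rw [hw', C_mul, map_mul]
    ring
  rw [hdiff]
  exact Submodule.add_mem _ hmain (Submodule.add_mem _ (Ideal.mul_mem_left _ _ hu) (Ideal.mul_mem_left _ _ hσ2))

/-- The transported and substituted `tau y` is `y` up to weight `≥ 1` (any weight with `ω i ≥ 1`). [folklore] -/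
theorem IsRootTower.substQ_tau_sub_C_mem (h : IsRootTower L K (p ^ 1) x a) (hp2 : p ≠ 2) (b c : K) (ω : Fin 2 → ℕ)
    (hω : ∀ i, 1 ≤ ω i) (y : K) :
    substQ K b c (h.tau y) - Ideal.Quotient.mk _ (C y) ∈ wdegIdeal K 2 (p ^ 1) ω 1 := by
  have hmain := h.substQ_tau_sub_mem hp2 b c ω hω y
  have hX0 : substQ K b c (Ideal.Quotient.mk _ (X 0)) ∈ wdegIdeal K 2 (p ^ 1) ω 1 :=
    substQ_mk_X_mem_wdegIdeal b c ω hω 0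
  have hX1 : Ideal.Quotient.mk (boxIdeal (Fin 2) K (p ^ 1)) (X 1) ∈ wdegIdeal K 2 (p ^ 1) ω 1 :=
    wdegIdeal_anti ω (hω 1) (mk_X_mem_wdegIdeal ω 1)
  have hdiff : substQ K b c (h.tau y) - Ideal.Quotient.mk _ (C y) =
      (substQ K b c (h.tau y) - (Ideal.Quotient.mk _ (C y) +
        Ideal.Quotient.mk _ (C (h.hsD (Finsupp.single 0 1) y)) * substQ K b c (Ideal.Quotient.mk _ (X 0)) +
        Ideal.Quotient.mk _ (C (h.hsD (Finsupp.single 1 1) y)) * Ideal.Quotient.mk _ (X 1))) +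
      (Ideal.Quotient.mk _ (C (h.hsD (Finsupp.single 0 1) y)) * substQ K b c (Ideal.Quotient.mk _ (X 0)) +
        Ideal.Quotient.mk _ (C (h.hsD (Finsupp.single 1 1) y)) * Ideal.Quotient.mk _ (X 1)) := by ring
  rw [hdiff]
  exact Submodule.add_mem _ (wdegIdeal_anti ω (by norm_num) hmain)
    (Submodule.add_mem _ (Ideal.mul_mem_left _ _ hX0) (Ideal.mul_mem_left _ _ hX1))

/-- **The conjugation identity**: for `E = D' ∘ D' − w·∂₀` (`D' = β'∂₀ + ∂₁` on `K`), `θ̄ = substQ β' (w/2)`,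
`θ̄ (E^♯ y) = heatPert ε ŵ (θ̄ y)` with `ε = θ̄(tau β') − β' − wσ`, `ŵ = θ̄(tau w)`.
[cite: Mizutani1973HironakaGroupSchemes, Lemma 2.9 (2) (proof outline)] -/
theorem IsRootTower.substQ_sharp_heat (h : IsRootTower L K (p ^ 1) x a) (hp2 : p ≠ 2) (β' w : K)
    (y : BoxQuot (Fin 2) K (p ^ 1)) :
    let D' : K →ₗ[L] K := β' • h.hsD (Finsupp.single 0 1) + h.hsD (Finsupp.single 1 1)
    let E : K →ₗ[L] K := D' ∘ₗ D' - w • h.hsD (Finsupp.single 0 1)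
    let ε := substQ K β' (w / 2) (h.tau β') - Ideal.Quotient.mk _ (C β') - Ideal.Quotient.mk _ (C w) * Ideal.Quotient.mk _ (X 1)
    substQ K β' (w / 2) (h.sharp E y) = heatPert K p ε (substQ K β' (w / 2) (h.tau w)) (substQ K β' (w / 2) y) := by
  intro D' E ε
  have h2 : (2 : K) ≠ 0 := two_ne_zero_of_ne_two hp2
  set θ := substQ K β' (w / 2) with hθ
  set d0 := boxDeriv K 2 (p ^ 1) 0 with hd0
  set d1 := boxDeriv K 2 (p ^ 1) 1 with hd1
  -- `E^♯` pointwise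
  have hV : ∀ z, h.sharp D' z = h.tau β' * d0 z + d1 z := by
    intro z
    show h.sharp (β' • h.hsD (Finsupp.single 0 1) + h.hsD (Finsupp.single 1 1)) z = _
    rw [h.sharp_add, LinearMap.add_apply, h.sharp_smul, h.sharp_hsD_single le_rfl, h.sharp_hsD_single le_rfl]
  have hE : ∀ z, h.sharp E z = h.sharp D' (h.sharp D' z) - h.tau w * d0 z := by
    intro z
    show h.sharp (D' ∘ₗ D' - w • h.hsD (Finsupp.single 0 1)) z = _
    rw [h.sharp_sub, LinearMap.sub_apply, h.sharp_comp, LinearMap.comp_apply, h.sharp_smul, h.sharp_hsD_single le_rfl]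
  -- the chain rule: `θ (V z) = heatVf ε (θ z)`
  have hg : Ideal.Quotient.mk (boxIdeal (Fin 2) K (p ^ 1)) (C β' + C (2 * (w / 2)) * X 1) =
      Ideal.Quotient.mk _ (C β') + Ideal.Quotient.mk _ (C w) * Ideal.Quotient.mk _ (X 1) := by
    rw [mul_div_cancel₀ w h2, map_add, map_mul]
  have hθV : ∀ z, θ (h.sharp D' z) = heatVf K p ε (θ z) := by
    intro z
    have hεdef : ε = substQ K β' (w / 2) (h.tau β') - Ideal.Quotient.mk _ (C β') -
        Ideal.Quotient.mk _ (C w) * Ideal.Quotient.mk _ (X 1) := rfl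
    rw [hV, map_add, map_mul, heatVf_apply, hθ, boxDeriv_one_substQ, hg, ← boxDeriv_zero_substQ, hεdef]
    ring
  rw [hE, map_sub, map_mul, hθV, hθV, heatPert_apply, hθ, ← boxDeriv_zero_substQ]

/-- **Case (v) of Lemma 2.9 (2), ⇒: degenerate symbol and `w ≠ 0` force `dim_L ker D ≤ p`** (`< 2p`).
[cite: Mizutani1973HironakaGroupSchemes, Lemma 2.9 (2) (proof outline, p. 94: «(½a)^{p−2}(D₁(a) + ½aD₂(a)) = 0»)] -/
theorem IsRootTower.finrank_ker_le_of_sq_of_ne_zero (h : IsRootTower L K (p ^ 1) x a) (hp2 : p ≠ 2)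
    {D : K →ₗ[L] K} (hD : IsDiffOpLE L 2 D) (h1 : D 1 = 0) (ha : ∀ i, D (a i) = 0) (hγ : D (a 1 ^ 2) ≠ 0)
    (hsq : D (a 0 ^ 2) * D (a 1 ^ 2) = D (a 0 * a 1) ^ 2)
    (hw : (D (a 0 * a 1) / D (a 1 ^ 2)) * h.hsD (Finsupp.single 0 1) (D (a 0 * a 1) / D (a 1 ^ 2)) +
      h.hsD (Finsupp.single 1 1) (D (a 0 * a 1) / D (a 1 ^ 2)) ≠ 0) :
    Module.finrank L (LinearMap.ker D) ≤ p := by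
  haveI := h.finiteDimensional
  have h2 : (2 : K) ≠ 0 := two_ne_zero_of_ne_two hp2
  set β' : K := D (a 0 * a 1) / D (a 1 ^ 2) with hβ'
  set w : K := β' * h.hsD (Finsupp.single 0 1) β' + h.hsD (Finsupp.single 1 1) β' with hwdef
  set D' : K →ₗ[L] K := β' • h.hsD (Finsupp.single 0 1) + h.hsD (Finsupp.single 1 1) with hD'
  set E : K →ₗ[L] K := D' ∘ₗ D' - w • h.hsD (Finsupp.single 0 1) with hE
  -- `D = (γ/2) · E`
  have hDE : D = (D (a 1 ^ 2) / 2) • E := by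
    have key := h.eq_smul_comp_sub_smul hp2 hD h1 ha hγ hsq
    simp only at key
    rw [← hβ'] at key
    rw [← hwdef, ← hD'] at key
    conv_lhs => rw [key]
    rw [hE]
    ext y
    simp only [LinearMap.sub_apply, LinearMap.smul_apply, LinearMap.comp_apply, smul_eq_mul]
    ring
  have hker : LinearMap.ker D = LinearMap.ker E := by
    rw [hDE]
    ext y
    simp only [LinearMap.mem_ker, LinearMap.smul_apply, smul_eq_mul, mul_eq_zero, div_eq_zero_iff, hγ, h2, or_self,
      false_or]
  rw [hker]
  refine le_trans (h.finrank_ker_le_finrank_ker_sharp E) ?_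
  -- conjugate by the substitution and apply the heat-kernel bound
  set θ := substEquiv K β' (w / 2) with hθ
  set ε := substQ K β' (w / 2) (h.tau β') - Ideal.Quotient.mk _ (C β') - Ideal.Quotient.mk _ (C w) * Ideal.Quotient.mk _ (X 1)
    with hε
  set ŵ := substQ K β' (w / 2) (h.tau w) with hŵ
  have hkerP : LinearMap.ker (heatPert K p ε ŵ) = (LinearMap.ker (h.sharp E)).map θ.toLinearEquiv.toLinearMap := by
    ext z
    rw [LinearMap.mem_ker, Submodule.mem_map_equiv, LinearMap.mem_ker]
    have hz : z = substQ K β' (w / 2) (θ.toLinearEquiv.symm z) := by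
      show z = θ (θ.symm z)
      rw [AlgEquiv.apply_symm_apply]
    constructor
    · intro hz0
      have key := h.substQ_sharp_heat hp2 β' w (θ.toLinearEquiv.symm z)
      simp only at key
      rw [← hz] at key
      rw [hz0] at key
      -- `θ` is injective
      have : substQ K β' (w / 2) (h.sharp E (θ.toLinearEquiv.symm z)) = substQ K β' (w / 2) 0 := by
        rw [key, map_zero]
      exact (substEquiv K β' (w / 2)).injective this
    · intro hz0
      have key := h.substQ_sharp_heat hp2 β' w (θ.toLinearEquiv.symm z)
      simp only at key
      rw [← hz, hz0, map_zero] at key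
      exact key.symm
  have hfin : Module.finrank K (LinearMap.ker (h.sharp E)) = Module.finrank K (LinearMap.ker (heatPert K p ε ŵ)) := by
    rw [hkerP, LinearEquiv.finrank_map_eq]
  rw [hfin]
  exact finrank_ker_heatPert_le hw (h.eps_mem_wdegIdeal hp2 β')
    (h.substQ_tau_sub_C_mem hp2 β' (w / 2) heatWeight (fun i => by fin_cases i <;> simp) w)

end Heat

end Summit.ResolutionOfSingularities.KangarooAtlas.Mizutani
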